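import Summits.Ventures.LatticeQCDFlow.Scaling.HubChainStartContentCoverShallow
import Summits.Ventures.LatticeQCDFlow.Scaling.HubClassGlobalDomination

/-!
HONEST FRAMING: exact (Metropolis-corrected) sampling algorithms for lattice gauge theory; figures
of merit are autocorrelation/cost numbers at stated couplings and volumes; no continuum-physics
claim.

# HubClassStartContentCoverEnum — CONJECTURE Σ IN CHAPTER W'S LANGUAGE (GIVEN A COMMON SORTED ENUMERATION): FOR THE HUB KERNELS OF TWO PROFILES THAT DEEPEN ONE CONTENT `t` OF WEIGHT
# `1` WITHOUT CROSSING ANOTHER, `Kh_Yⁿ(N;z,z) ≤ Kh_Xⁿ(N;z,z) + Kh_Xⁿ(N;z,t)` FOR EVERY `n` AND EVERY PRESENT `z ≠ t` (lean-2 GEN-40, ours)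

Venture-side (OURS).  Cell `lqcd-flow` (pub-lqcd), unit `pub-lqcd-lean-2-g40`, 2026-08-30.  Chapter Z, file 11.  Z6∕Z7∕Z10 (and Z2 for shallow starts) prove Conjecture Σ on `ℕ`-ranks in all
four configurations.  Here, as Z3 did for M′, the statement is moved to chapter W's hub kernel `Kh(N;h,v) = 𝟙{N(h)≠0}(N(v)/K)min{1,W_h/W_v}` on a finite content type, for two persistence
profiles agreeing off a present content `t` of weight `N(t) = 1`, `W^Y_t ≤ W^X_t`, `Σ_vN(v) = K+1` (`K ≥ 2`), GIVEN a common enumeration of the present contents sorted for both profiles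
(it exists when no present content lies strictly between the two persistences of `t`, Z3 `global_sorted_of_key`):

* the `ℕ`-indexed KERNELS are built from the enumeration (off-diagonal by the formula, diagonal by the row sum on the ranks, powers by the rank recursion) and identified with `Kh`, `Khⁿ` on
  the present contents through Y12 (`dict_Kh_offdiag`, `dict_Kh_diag`, `dict_Khn_succ`);
* **`hubClass_startClass_cover_of_enum`**: `Kh_Yⁿ(N;z,z) ≤ Kh_Xⁿ(N;z,z) + Kh_Xⁿ(N;z,t)` for every `n` and every present `z ≠ t` — by cases on the ranks of `z` and `t` and the number of
  particles at or above them: Z6 `startClass_cover` (deep start, three particles), Z7 `startClass_cover_pair` (`(t,z)` at ranks `(0,1)`, one particle each), Z2 `perStep_pow_diag_le`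
  (shallow start, three particles: no deficit), Z10 `startClass_cover_shallow` (`(z,t)` at ranks `(0,1)`).

File Z12 removes the enumeration (no content strictly between) and instantiates W26's tagged chains.  Literature grade (cell rule): OWN, plumbing; nothing cited; no new bib keys.
-/

open Finset

namespace Summit.Ventures.LatticeQCDFlow.Scaling

section CoverEnum
variable {S : Type*} [Fintype S] [DecidableEq S]

/-- **Σ given a common sorted enumeration** (see the module docstring). [ours] -/
theorem hubClass_startClass_cover_of_enum {WX WY : S → ℝ} {accX accY : S → S → ℝ} {KhX KhY : (S → ℕ) → S → S → ℝ} {K : ℕ} {N : S → ℕ} {t : S}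
    {KhnX KhnY : ℕ → S → S → ℝ} {e : ℕ → S} {m : ℕ}
    (hWX : ∀ v, 0 < WX v) (hWY : ∀ v, 0 < WY v) (hagree : ∀ v, v ≠ t → WX v = WY v) (hWt : WY t ≤ WX t)
    (haccX : ∀ h v, accX h v = min 1 (WX h / WX v)) (haccY : ∀ h v, accY h v = min 1 (WY h / WY v)) (hK : 2 ≤ K)
    (hNK : ∑ v, (N v : ℝ) = K + 1) (hNt : N t = 1)
    (hKXoff : ∀ N' h v, h ≠ v → KhX N' h v = if N' h = 0 then 0 else (N' v : ℝ) / K * accX h v)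
    (hKXdiag : ∀ N' h, KhX N' h h = 1 - ∑ v ∈ univ.erase h, KhX N' h v)
    (hKYoff : ∀ N' h v, h ≠ v → KhY N' h v = if N' h = 0 then 0 else (N' v : ℝ) / K * accY h v)
    (hKYdiag : ∀ N' h, KhY N' h h = 1 - ∑ v ∈ univ.erase h, KhY N' h v)
    (hKhnX0 : ∀ h v, KhnX 0 h v = if h = v then 1 else 0) (hKhnXs : ∀ n h v, KhnX (n + 1) h v = ∑ w, KhnX n h w * KhX N w v)
    (hKhnY0 : ∀ h v, KhnY 0 h v = if h = v then 1 else 0) (hKhnYs : ∀ n h v, KhnY (n + 1) h v = ∑ w, KhnY n h w * KhY N w v)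
    (he_inj : ∀ i j, i < m → j < m → e i = e j → i = j) (he_pres : ∀ i, i < m → N (e i) ≠ 0) (he_cov : ∀ v, N v ≠ 0 → ∃ i, i < m ∧ e i = v)
    (hsortX : ∀ i j, i ≤ j → j < m → WX (e j) ≤ WX (e i)) (hsortY : ∀ i j, i ≤ j → j < m → WY (e j) ≤ WY (e i))
    (n : ℕ) {z : S} (hzt : z ≠ t) (hz : N z ≠ 0) :
    KhnY n z z ≤ KhnX n z z + KhnX n z t := by
  classical
  have hNt0 : N t ≠ 0 := by rw [hNt]; exact one_ne_zero
  obtain ⟨i, hi, rfl⟩ := he_cov z hz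
  obtain ⟨s, hs, hst⟩ := he_cov t hNt0
  have his : i ≠ s := fun h => hzt (by rw [h, hst])
  have hK1 : 1 ≤ K := by omega
  have hWXY : ∀ v, WY v ≤ WX v := fun v => by
    by_cases hv : v = t
    · rw [hv]; exact hWt
    · rw [hagree v hv]
  have het : ∀ l, l < m → l ≠ s → e l ≠ t := fun l hl hls h => hls (he_inj l s hl hs (by rw [h, hst]))
  -- the `ℕ`-indexed data (as in Z3)
  obtain ⟨c, hc⟩ : ∃ c : ℝ, c = 1 / K := ⟨_, rfl⟩
  obtain ⟨ρX, hρX⟩ : ∃ ρX : ℕ → ℝ, ∀ l, ρX l = if l < m then 1 / WX (e l) else 1 / WY (e (m - 1)) := ⟨_, fun _ => rfl⟩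
  obtain ⟨ρY, hρY⟩ : ∃ ρY : ℕ → ℝ, ∀ l, ρY l = if l < m then 1 / WY (e l) else 1 / WY (e (m - 1)) := ⟨_, fun _ => rfl⟩
  obtain ⟨Nn, hNn⟩ : ∃ Nn : ℕ → ℝ, ∀ l, Nn l = if l < m then (N (e l) : ℝ) else 1 := ⟨_, fun _ => rfl⟩
  obtain ⟨RX, hRX⟩ : ∃ RX : ℕ → ℝ, ∀ k, RX k = ∑ i ∈ range k, Nn i * ρX i := ⟨_, fun _ => rfl⟩
  obtain ⟨RY, hRY⟩ : ∃ RY : ℕ → ℝ, ∀ k, RY k = ∑ i ∈ range k, Nn i * ρY i := ⟨_, fun _ => rfl⟩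
  obtain ⟨M, hM⟩ : ∃ M : ℕ → ℝ, ∀ k, M k = ∑ i ∈ Ico k m, Nn i := ⟨_, fun _ => rfl⟩
  obtain ⟨βX, hβX⟩ : ∃ βX : ℕ → ℝ, ∀ k, βX k = 1 - c * (M k + RX k / ρX k) := ⟨_, fun _ => rfl⟩
  obtain ⟨βY, hβY⟩ : ∃ βY : ℕ → ℝ, ∀ k, βY k = 1 - c * (M k + RY k / ρY k) := ⟨_, fun _ => rfl⟩
  obtain ⟨a, ha⟩ : ∃ a : ℕ → ℝ, ∀ l, a l = 1 - c * M (l + 1) := ⟨_, fun _ => rfl⟩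
  obtain ⟨TX, hTX⟩ : ∃ TX : ℕ → ℕ → ℝ, ∀ n j, TX n j = (1 - βX j ^ n) / RX m + ∑ k ∈ Ico (j + 1) m, (1 / RX k - 1 / RX (k + 1)) * (βX k ^ n - βX j ^ n) :=
    ⟨_, fun _ _ => rfl⟩
  obtain ⟨TY, hTY⟩ : ∃ TY : ℕ → ℕ → ℝ, ∀ n j, TY n j = (1 - βY j ^ n) / RY m + ∑ k ∈ Ico (j + 1) m, (1 / RY k - 1 / RY (k + 1)) * (βY k ^ n - βY j ^ n) :=
    ⟨_, fun _ _ => rfl⟩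
  obtain ⟨fX, hfX⟩ : ∃ fX : ℕ → ℕ → ℝ, ∀ k i, fX k i = if i < k then ρX k else if i = k then -(RX k / Nn k) else 0 := ⟨_, fun _ _ => rfl⟩
  obtain ⟨fY, hfY⟩ : ∃ fY : ℕ → ℕ → ℝ, ∀ k i, fY k i = if i < k then ρY k else if i = k then -(RY k / Nn k) else 0 := ⟨_, fun _ _ => rfl⟩
  -- the `ℕ`-indexed kernels and powers
  obtain ⟨offX, hoffX⟩ : ∃ off : ℕ → ℕ → ℝ, ∀ i j, off i j = c * Nn j * min 1 (ρX j / ρX i) := ⟨_, fun _ _ => rfl⟩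
  obtain ⟨offY, hoffY⟩ : ∃ off : ℕ → ℕ → ℝ, ∀ i j, off i j = c * Nn j * min 1 (ρY j / ρY i) := ⟨_, fun _ _ => rfl⟩
  obtain ⟨PX, hPX⟩ : ∃ P : ℕ → ℕ → ℝ, ∀ i j, P i j = if i = j then 1 - ∑ l ∈ (range m).erase i, offX i l else offX i j := ⟨_, fun _ _ => rfl⟩
  obtain ⟨PY, hPY⟩ : ∃ P : ℕ → ℕ → ℝ, ∀ i j, P i j = if i = j then 1 - ∑ l ∈ (range m).erase i, offY i l else offY i j := ⟨_, fun _ _ => rfl⟩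
  have hPXoff : ∀ i j, i ≠ j → PX i j = c * Nn j * min 1 (ρX j / ρX i) := fun i j h => by rw [hPX, if_neg h, hoffX]
  have hPYoff : ∀ i j, i ≠ j → PY i j = c * Nn j * min 1 (ρY j / ρY i) := fun i j h => by rw [hPY, if_neg h, hoffY]
  have hPXdiag : ∀ i, PX i i = 1 - ∑ j ∈ (range m).erase i, PX i j := fun i => by
    rw [hPX, if_pos rfl]; congr 1; exact sum_congr rfl fun j hj => by rw [hPX, if_neg (ne_of_mem_erase hj).symm]
  have hPYdiag : ∀ i, PY i i = 1 - ∑ j ∈ (range m).erase i, PY i j := fun i => by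
    rw [hPY, if_pos rfl]; congr 1; exact sum_congr rfl fun j hj => by rw [hPY, if_neg (ne_of_mem_erase hj).symm]
  let PnX : ℕ → ℕ → ℕ → ℝ := fun n => Nat.rec (motive := fun _ => ℕ → ℕ → ℝ) (fun i j => if i = j then 1 else 0) (fun _ prev i j => ∑ l ∈ range m, prev i l * PX l j) n
  let PnY : ℕ → ℕ → ℕ → ℝ := fun n => Nat.rec (motive := fun _ => ℕ → ℕ → ℝ) (fun i j => if i = j then 1 else 0) (fun _ prev i j => ∑ l ∈ range m, prev i l * PY l j) n
  have hPX0 : ∀ i j, PnX 0 i j = if i = j then 1 else 0 := fun _ _ => rfl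
  have hPXs : ∀ n i j, PnX (n + 1) i j = ∑ l ∈ range m, PnX n i l * PX l j := fun _ _ _ => rfl
  have hPY0 : ∀ i j, PnY 0 i j = if i = j then 1 else 0 := fun _ _ => rfl
  have hPYs : ∀ n i j, PnY (n + 1) i j = ∑ l ∈ range m, PnY n i l * PY l j := fun _ _ _ => rfl
  -- elementary facts (as in Z3)
  have hρXpos : ∀ l, 0 < ρX l := fun l => by rw [hρX]; split_ifs <;> exact one_div_pos.mpr (by first | exact hWX _ | exact hWY _)
  have hρYpos : ∀ l, 0 < ρY l := fun l => by rw [hρY]; split_ifs <;> exact one_div_pos.mpr (hWY _)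
  have hNnpos : ∀ l, 0 < Nn l := fun l => by
    rw [hNn]; split_ifs with h
    · exact_mod_cast Nat.pos_of_ne_zero (he_pres l h)
    · exact one_pos
  have hNn1 : ∀ l, 1 ≤ Nn l := fun l => by
    rw [hNn]; split_ifs with h
    · exact_mod_cast Nat.one_le_iff_ne_zero.mpr (he_pres l h)
    · exact le_rfl
  have hmonoX : Monotone ρX := by
    intro l l' hll'
    rw [hρX, hρX]
    by_cases hl' : l' < m
    · rw [if_pos hl', if_pos (by omega : l < m)]; exact one_div_le_one_div_of_le (hWX _) (hsortX l l' hll' hl')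
    · rw [if_neg hl']
      by_cases hl : l < m
      · rw [if_pos hl]; exact one_div_le_one_div_of_le (hWY _) ((hWXY _).trans (hsortX l (m - 1) (by omega) (by omega)))
      · rw [if_neg hl]
  have hmonoY : Monotone ρY := by
    intro l l' hll'
    rw [hρY, hρY]
    by_cases hl' : l' < m
    · rw [if_pos hl', if_pos (by omega : l < m)]; exact one_div_le_one_div_of_le (hWY _) (hsortY l l' hll' hl')
    · rw [if_neg hl']
      by_cases hl : l < m
      · rw [if_pos hl]; exact one_div_le_one_div_of_le (hWY _) (hsortY l (m - 1) (by omega) (by omega))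
      · rw [if_neg hl]
  have hagree' : ∀ l, l ≠ s → ρX l = ρY l := by
    intro l hls
    rw [hρX, hρY]
    by_cases hl : l < m
    · rw [if_pos hl, if_pos hl, hagree (e l) (het l hl hls)]
    · rw [if_neg hl, if_neg hl]
  have htag' : ρX s ≤ ρY s := by
    rw [hρX, hρY, if_pos hs, if_pos hs, hst]; exact one_div_le_one_div_of_le (hWY t) hWt
  have hKpos : (0 : ℝ) < K := by exact_mod_cast (show 0 < K by omega)
  have hcpos : 0 < c := by rw [hc]; positivity
  have hM0 : M 0 = ∑ v, (N v : ℝ) := by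
    rw [hM, dict_sum_present he_inj he_cov (F := fun v => (N v : ℝ)) (fun v hv => by simp [hv])]
    refine sum_congr (by ext l; simp) fun l hl => ?_
    rw [hNn, if_pos (mem_range.mp hl)]
  have hcK : c * M 0 = 1 + c := by rw [hM0, hNK, hc]; field_simp
  -- the kernel link on the ranks `< m`
  have hlinkX : ∀ l j, l < m → j < m → KhX N (e l) (e j) = PX l j := by
    intro l j hl hj
    by_cases hlj : l = j
    · subst hlj
      rw [dict_Kh_diag hKXoff hKXdiag he_inj he_pres he_cov hl, hPXdiag]
      congr 1
      refine sum_congr rfl fun j hj' => ?_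
      have hjm : j < m := mem_range.mp (mem_of_mem_erase hj')
      rw [dict_Kh_offdiag hWX haccX hKXoff he_inj he_pres hl hjm (ne_of_mem_erase hj').symm, hPXoff l j (ne_of_mem_erase hj').symm, hNn, if_pos hjm, hρX, hρX, if_pos hjm, if_pos hl, hc]
    · have hne : e l ≠ e j := fun h => hlj (he_inj l j hl hj h)
      rw [dict_Kh_offdiag hWX haccX hKXoff he_inj he_pres hl hj hlj, hPXoff l j hlj, hNn, if_pos hj, hρX, hρX, if_pos hj, if_pos hl, hc]
  have hlinkY : ∀ l j, l < m → j < m → KhY N (e l) (e j) = PY l j := by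
    intro l j hl hj
    by_cases hlj : l = j
    · subst hlj
      rw [dict_Kh_diag hKYoff hKYdiag he_inj he_pres he_cov hl, hPYdiag]
      congr 1
      refine sum_congr rfl fun j hj' => ?_
      have hjm : j < m := mem_range.mp (mem_of_mem_erase hj')
      rw [dict_Kh_offdiag hWY haccY hKYoff he_inj he_pres hl hjm (ne_of_mem_erase hj').symm, hPYoff l j (ne_of_mem_erase hj').symm, hNn, if_pos hjm, hρY, hρY, if_pos hjm, if_pos hl, hc]
    · rw [dict_Kh_offdiag hWY haccY hKYoff he_inj he_pres hl hj hlj, hPYoff l j hlj, hNn, if_pos hj, hρY, hρY, if_pos hj, if_pos hl, hc]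
  have hpowX : ∀ n l j, l < m → j < m → KhnX n (e l) (e j) = PnX n l j := by
    intro n; induction n with
    | zero =>
        intro l j hl hj
        rw [hKhnX0, hPX0]
        by_cases h : l = j
        · rw [if_pos (by rw [h]), if_pos h]
        · rw [if_neg (fun h' => h (he_inj l j hl hj h')), if_neg h]
    | succ n ih =>
        intro l j hl hj
        rw [dict_Khn_succ hKXoff he_inj he_pres he_cov hKhnX0 hKhnXs n hl hj, hPXs]
        exact sum_congr rfl fun k hk => by rw [ih l k hl (mem_range.mp hk), hlinkX k j (mem_range.mp hk) hj]
  have hpowY : ∀ n l j, l < m → j < m → KhnY n (e l) (e j) = PnY n l j := by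
    intro n; induction n with
    | zero =>
        intro l j hl hj
        rw [hKhnY0, hPY0]
        by_cases h : l = j
        · rw [if_pos (by rw [h]), if_pos h]
        · rw [if_neg (fun h' => h (he_inj l j hl hj h')), if_neg h]
    | succ n ih =>
        intro l j hl hj
        rw [dict_Khn_succ hKYoff he_inj he_pres he_cov hKhnY0 hKhnYs n hl hj, hPYs]
        exact sum_congr rfl fun k hk => by rw [ih l k hl (mem_range.mp hk), hlinkY k j (mem_range.mp hk) hj]
  rw [hpowY n i i hi hi, hpowX n i i hi hi, ← hst, hpowX n i s hi hs]
  -- particle counts: `M_0 − M_{k+1} = Σ_{l ≤ k} N_l`, each `≥ 1`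
  have hMsplit : ∀ k, k < m → M 0 = ∑ l ∈ range (k + 1), Nn l + M (k + 1) := fun k hk => by
    rw [hM, hM, ← Finset.range_eq_Ico]; exact (Finset.sum_range_add_sum_Ico _ (by omega : k + 1 ≤ m)).symm
  have hcount : ∀ k, k < m → ((k : ℝ) + 1) ≤ ∑ l ∈ range (k + 1), Nn l := fun k hk => by
    have := Finset.card_nsmul_le_sum (range (k + 1)) Nn 1 (fun l _ => hNn1 l)
    rw [card_range, nsmul_eq_mul, mul_one] at this
    exact_mod_cast this
  have hNs : Nn s = 1 := by rw [hNn, if_pos hs, hst, hNt]; simp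
  have hM3 : M 3 + 3 ≤ M 0 := by
    -- at least three particles at ranks `< 3`: either `m ≥ 3` (three present classes) or all `K + 1 ≥ 3` particles sit at ranks `< m ≤ 3`
    rcases Nat.lt_or_ge m 3 with hm3 | hm3
    · have hM3z : M 3 = 0 := by rw [hM]; exact sum_eq_zero fun l hl => by have := (mem_Ico.mp hl); omega
      have : (3 : ℝ) ≤ K + 1 := by exact_mod_cast (show 3 ≤ K + 1 by omega)
      rw [hM3z, hM0, hNK]; linarith
    · have h := hMsplit 2 (by omega)
      have h2 := hcount 2 (by omega)
      norm_num at h2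
      linarith
  -- the four configurations
  rcases Nat.lt_or_gt_of_ne his with his' | hsi
  · -- start shallower than the tag
    by_cases h3 : M (s + 1) + 3 ≤ M 0
    · have h := perStep_pow_diag_le hρXpos hmonoX hρYpos hmonoY hagree' htag' hNnpos hRX hRY hM hPXoff hPXdiag hPYoff hPYdiag hfX hfY hβX hβY ha hPX0 hPXs hPY0 hPYs hTX hTY
        hcpos.le hcK.le n his' hs h3
      have hnn := cover_pow_nonneg hPX0 hPXs (fun l hl j => cover_P_nonneg hρXpos hmonoX hNnpos hNn1 hRX hM hPXoff hPXdiag hβX hcpos.le hcK.le hl j) n i s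
      linarith
    · -- fewer than three particles at ranks `≤ s`: then `(i,s) = (0,1)` with one particle each
      have hlt : ∑ l ∈ range (s + 1), Nn l < 3 := by linarith [hMsplit s hs]
      have hs1 : s = 1 := by
        have := hcount s hs
        have : (s : ℝ) < 2 := by linarith
        have : s < 2 := by exact_mod_cast this
        omega
      have hi0 : i = 0 := by omega
      subst hs1; subst hi0
      have hN1' : Nn 0 = 1 := by
        have hsum : ∑ l ∈ range 2, Nn l = Nn 0 + Nn 1 := by simp [sum_range_succ]
        rw [hsum, hNs] at hlt
        have h0 := hNn1 0
        have : Nn 0 = (N (e 0) : ℝ) := by rw [hNn, if_pos hi]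
        rw [this] at hlt h0 ⊢
        have : N (e 0) < 2 := by exact_mod_cast (show (N (e 0) : ℝ) < 2 by linarith)
        have : 1 ≤ N (e 0) := by exact_mod_cast h0
        exact_mod_cast (show N (e 0) = 1 by omega)
      exact startClass_cover_shallow hρXpos hmonoX hρYpos hmonoY hagree' htag' hNnpos hRX hRY hM hPXoff hPXdiag hPYoff hPYdiag hfX hfY hβX hβY ha hPX0 hPXs hPY0 hPYs hTX hTY
        hcpos hcK hN1' hNs hs hM3 n
  · -- start deeper than the tag
    by_cases h3 : M (i + 1) + 3 ≤ M 0
    · exact startClass_cover hρXpos hmonoX hρYpos hmonoY hagree' htag' hNnpos hNn1 hRX hRY hM hPXoff hPXdiag hPYoff hPYdiag hfX hfY hβX hβY ha hPX0 hPXs hPY0 hPYs hTX hTY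
        hcpos.le hcK.le hsi hi h3 n
    · have hlt : ∑ l ∈ range (i + 1), Nn l < 3 := by linarith [hMsplit i hi]
      have hi1 : i = 1 := by
        have := hcount i hi
        have : (i : ℝ) < 2 := by linarith
        have : i < 2 := by exact_mod_cast this
        omega
      have hs0 : s = 0 := by omega
      subst hi1; subst hs0
      have hN1' : Nn 1 = 1 := by
        have hsum : ∑ l ∈ range 2, Nn l = Nn 0 + Nn 1 := by simp [sum_range_succ]
        rw [hsum, hNs] at hlt
        have h1 := hNn1 1
        have : Nn 1 = (N (e 1) : ℝ) := by rw [hNn, if_pos hi]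
        rw [this] at hlt h1 ⊢
        have : N (e 1) < 2 := by exact_mod_cast (show (N (e 1) : ℝ) < 2 by linarith)
        have : 1 ≤ N (e 1) := by exact_mod_cast h1
        exact_mod_cast (show N (e 1) = 1 by omega)
      exact startClass_cover_pair hρXpos hmonoX hρYpos hmonoY hagree' htag' hNnpos hNn1 hRX hRY hM hPXoff hPXdiag hPYoff hPYdiag hfX hfY hβX hβY ha hPX0 hPXs hPY0 hPYs hTX hTY
        hcpos hcK hNs hN1' hi hM3 n

end CoverEnum

end Summit.Ventures.LatticeQCDFlow.Scaling
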